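import Literature.MathematicalPhysics.QuantumFieldTheory.Balaban1983to89.B9Ineq385Kernel
import Literature.MathematicalPhysics.QuantumFieldTheory.Balaban1983to89.B9Ineq349Hom
import Literature.MathematicalPhysics.QuantumFieldTheory.Balaban1983to89.B6RandomWalkSection
import Literature.MathematicalPhysics.QuantumFieldTheory.Balaban1983to89.B9Eq352GradLetters

/-!
# `Balaban1983to89.B9Ineq349KernelU` — [Balaban1985BackgroundPropagators] (3.49) p. 399 FOR PRINT'S OWN `P(U) = G′(U)Q′*(U)(Q′G′²Q′*)⁻¹(U)Q′(U)G′(U)`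
# IN THE PRINTED KERNEL FORM `[|P(x,x′)|, |(∇P)_k(x,x′)|, |(P∇*)_l(x,x′)|, |(∇P∇*)_{kl}(x,x′)|] ≦ K[1, (Lʲη)⁻¹, (Lʲη)⁻¹, (Lʲη)⁻²](L^{j′}η)^{−d}e^{−(1/2)δ₀d(y,y′)}`
# AT THE PRINTED RATE `(1/2)δ₀`, from Theorem 3.1 for `G′(U)` and Theorem 3.2 for `U` «using again Lemma 2.1» — FILE 62 of the Sect. A/B programme of
# cell `lit-balaban`, seat r06 (B9 fold owner) gen 23: the background-`U` companion of FILE 30 (`B9Thm34PKernelFinal`, (3.49) for `P(U′U)`)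

statement-level skeleton of published theorems with citation tags; proofs where landed; nothing here is a claim about the Yang–Mills mass gap

CITATION HEADER (lean-in-tree rule).  B9 = T. Bałaban, *Propagators for lattice gauge theories in a background field*, Commun. Math. Phys. **99** (1985)
389–434 [Balaban1985BackgroundPropagators] (held `paper:balaban1985-cmp99-background-propagators`, journal page = PDF page + 388; page render
`b2b-balaban-ref1/pages/1985-cmp99-background-propagators/…-p011-x2.png` re-read by this seat 2026-08-23).  (3.49) p. 399 [PDF 11, L4–9] «These
theorems imply all the properties of the operator R, or DRD*, we will need in the future. For the operator P = I − R we obtain, using again Lemma 2.1,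
[|P(x,x′)|, |(DP)_μ(x,x′)|, |(PD*)_ν(x,x′)|, |(DPD*)_{μν}(x,x′)|] ≦ O(1)[1, (Lʲη)⁻¹, (Lʲη)⁻¹, (Lʲη)⁻²](L^{j′}η)^{−d}e^{−(1/2)δ₀d(y,y′)} for x ∈ Δ(y),
y ∈ Λ_j, x′ ∈ Δ(y′), y′ ∈ Λ_{j′}.» (the printed KERNEL shape = `B6RandomWalkKernel.HasKernelBound`: kernels for the pairing of p. 393, block volume
weight `v(y′) = (L^{j′}η)^d`); (3.25) p. 394 «Rf = (I − G′Q′*(Q′G′²Q′*)⁻¹Q′G′)f, where G′ = G′(U) = (Δ′_a)⁻¹», hence `P = I − R = G′Q′*(Q′G′²Q′*)⁻¹Q′G′`;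
Theorem 3.1 (3.42) p. 397 (the entries `G′`, `∇_UG′`, `G′∇*_U`, rate `δ₀`); Theorem 3.2 (3.48) p. 398 «Under the assumptions of Theorem 3.1, and with
the same constants, the following inequality holds: |(Q′(U)G′²(U)Q′*(U))⁻¹(y,y′)| ≦ B₀(Lʲη)⁻⁴(L^{j′}η)^{−d}e^{−δ₀d(y,y′)}, (y ∈ Λ_j, y′ ∈ Λ_{j′})»; (3.19)
p. 393 (the block-local averaging `Q′_j(U)`); p. 398 [PDF 10] L20–24 «Next, the choice of powers Lʲη is conventional also. Using Lemma 2.1 in [4] we may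
replace the factor (Lʲη)^α by (Lʲη)^β(L^{j′}η)^γ with β + γ = α, j, j′ are indices of localizations».  [4] = [Balaban1984PropagatorsII] T. Bałaban,
*Propagators and renormalization transformations for lattice gauge theories. II*, Commun. Math. Phys. **96** (1984) 223–250: (2.51)–(2.55) p. 232
(block majorants, products «insert Σ_{y″}Δ(y″) = I»), Lemma 2.1 (2.60)–(2.61) p. 234, (2.64)–(2.66) p. 234 (the kernel shape).  Row B9.Eq3.49 (cells;
the head is the lead's word).

WHAT IS PROVED (theorems only: 0 `def`, 0 sorry, 0 named facts; standard axioms).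
* §1 **`ineq349_kernel_word`** — the GENERIC device (any site carrier `W`, any index families of left letters `X k` and right letters `Y l`): from a
  block majorant `B_G(Lʲη)²e^{−δd}` of `G′`, block majorants `B_G(Lʲη)e^{−δd}` of the left words `X_k·G′` ((3.42)₁,₂ as majorants), KERNEL bounds
  `B_G(Lʲη)²e^{−δd}(L^{j′}η)^{−d}` of `G′` and `B_G(Lʲη)e^{−δd}(L^{j′}η)^{−d}` of the right words `G′·Y_l` ((3.42)₁,₃ as kernels), block-local two-space
  majorants `κ_Q` of the (3.19) letters `Q′`, `Q′*` and a block majorant `B₁(Lʲη)⁻⁴e^{−δd}` of `C⁻¹ = (Q′G′²Q′*)⁻¹` ((3.48) read on 𝔅), with [4] Lemma 2.1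
  at exponent `β`, the p. 398 scale transfers at exponent `α` (constant `Λ`) and the rates `ρ + (α+β)δ₀ ≦ ρ₁`, `ρ₁ + (2α+β)δ₀ ≦ δ`: the four KERNEL bounds of
  `P = G′Q′*C⁻¹Q′G′`, `X_k·P`, `P·Y_l`, `X_k·P·Y_l` with the weights `1, (Lʲη)⁻¹, (Lʲη)⁻¹, (Lʲη)⁻²`, ONE explicit constant
  `K = κ_Q²B_G²B₁Λ⁵c₁(β)³` and the rate `ρ`.  PROOF = print's «using again Lemma 2.1»: the prefix word `(X·G′)·Q′*·C⁻¹·Q′` as a block majorant by gen 11's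
  two-space word calculus `B9Ineq349Hom.hasMajorantHom_word349` ([4] (2.52)–(2.55)), then «block majorant × kernel of the right letter `G′·Y` ⇒ kernel»
  (`B9Ineq385Kernel.hasKernelBound_comp_decay`, the factor `(L^{j′}η)^{−d}` riding on the right letter).
* §2 **`ineq349_kernel_printed`** — THE PRINTED INSTANCE: site carrier `S × ι` (real coordinates `b` of `𝔸`), the letters `∇_k = conj b (diffLetter T U
  η⁻¹ k)`, `k : κ ⊕ κ` (forward/backward covariant differences of (3.3)/(3.8), the typing of FILES 16/25/29/30/33), `P(U) = G′(U) ∘ Q′*(U) ∘ C⁻¹(U) ∘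
  Q′(U) ∘ G′(U)` (the word of FILE 28's concrete `Δ_a(U)`, `R(U) = 1 − P(U)`), the (3.48) kernel bound of Theorem 3.2 in its own typing
  (`B9Thm34Inv.ker (vol g d)`), [4] Lemma 2.1 «for every 0 < α < 1» and the p. 398 transfers for every exponent — HYPOTHESES = the `U`-side subset of
  FILE 30's `thm34_P_kernel_final`, VERBATIM SHAPES — and the conclusion AT THE PRINTED RATE `(1/2)δ₀` (exponents `α = β = 1/10`:
  `δ₀ − (2α+β)δ₀ − (α+β)δ₀ = δ₀/2`): `∃ K ≧ 0` with `|P(U)(x,x′)| ≦ Ke^{−(δ₀/2)d}v(y′)⁻¹`, `|(∇_kP(U))(x,x′)|, |(P(U)∇*_l)(x,x′)| ≦ K(Lʲη)⁻¹e^{−(δ₀/2)d}v⁻¹`,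
  `|(∇_kP(U)∇*_l)(x,x′)| ≦ K(Lʲη)⁻²e^{−(δ₀/2)d}v⁻¹`.

HONEST SCOPE / NOT CLAIMED.  (i) Theorems 3.1/3.2 FOR `U` are the INPUTS (rows B9.Thm3.1/B9.Thm3.2): the file certifies print's implication «Theorems
3.1, 3.2 ⇒ (3.49)» for print's own `P(U)`, in the printed pointwise-kernel form and at the printed rate; it does not prove Theorems 3.1/3.2.  (ii) The
kernel members of Theorem 3.1 are taken in BOTH readings (block majorants for the left words, kernel bounds for the right words), as in FILES 16/29/30/33
(`HasKernelBound ⇒ HasMajorant` is `B6RandomWalkKernel.hasMajorant_of_hasKernelBound` under the p. 393 volume hypothesis; not re-derived here).  (iii) The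
(3.19) letters are abstract block-local two-space letters with the size `κ_Q` (print: `Q′_j(U)` of (3.19), `|Q′| ≦ 1`); `C⁻¹(U)` is any operator with the
(3.48) kernel bound (print: THE inverse of Theorem 3.2 — its inverse property is not used by the bound).  (iv) `∇*_l` is typed, as in the lineage, by the
same single-direction difference letters `conj b (diffLetter T U η⁻¹ l)` placed on the right (p. 398 «the choice of derivatives ∇_U, ∇*_U is conventional»);
the two-space gradient/divergence typing `conjHom b (gradLin …)`/`(divLin …)` of FILES 27/43 is not treated here.  (v) `K` depends on `κ_Q, B_G, B₁, d, δ₀`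
and the scale-transfer constant `Λ(1/10)` only («O(1)»); the Hölder remark after (3.49) is not treated.  NOT summit progress.

RELATED IN THE TREE, NOT DUPLICATED (searched 2026-08-23: `lean search --decl 'ineq349_kernel'` = pv16's ABSTRACT `B9Ineq349.ineq349_kernel` (kernel
families as real functions; the (3.25) composition dictionary `CompDominated`/`ObservedBy` and the three-factor convolution as hypotheses) only; `lean search --decl 'KernelU'` = ∅): FILE 30 `B9Thm34PKernelFinal.thm34_P_kernel_final`
((3.49) for the EXTENDED `P(U′U)`, rate `δ₀/5`), gen 6/12 `B9Ineq368PPrime.ineq349_op` / `B9Ineq349Hom.ineq349_hom` ((3.49) for `P(U)` as block MAJORANTS,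
operator form), r05's `B9Ineq349FlatTorus`/`…MultiLevelTorus(P23)` (U = 1 instances, hypothesis-free).  Here: `P(U)` itself, general `U`, printed
kernel form, printed rate.
-/

noncomputable section

namespace Literature.MathematicalPhysics.QuantumFieldTheory.Balaban1983to89.B9Ineq349KernelU

open NormedSpace Complex
open Literature.MathematicalPhysics.QuantumFieldTheory.Balaban1983to89
open Literature.MathematicalPhysics.QuantumFieldTheory.Balaban1983to89.B6RandomWalk (HasMajorant hasMajorant_mono Triangle254 Ineq261)
open Literature.MathematicalPhysics.QuantumFieldTheory.Balaban1983to89.B6RandomWalkHom (HasMajorantHom hasMajorantHom_mono hasMajorantHom_iff)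
open Literature.MathematicalPhysics.QuantumFieldTheory.Balaban1983to89.B6RandomWalkKernel (HasKernelBound hasKernelBound_mono)
open Literature.MathematicalPhysics.QuantumFieldTheory.Balaban1983to89.B9Thm34Ext (toB6)
open Literature.MathematicalPhysics.QuantumFieldTheory.Balaban1983to89.B9Ineq347 (ScaleTransfer)
open Literature.MathematicalPhysics.QuantumFieldTheory.Balaban1983to89.B9Eq352DivFormLetters (conj)
open Literature.MathematicalPhysics.QuantumFieldTheory.Balaban1983to89.B9Eq352GradLetters (diffLetter)
open Literature.MathematicalPhysics.QuantumFieldTheory.Balaban1983to89.B6RandomWalkSection (hasMajorant_id_of_ker)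
open Literature.MathematicalPhysics.QuantumFieldTheory.Balaban1983to89.B9Ineq349Hom (hasMajorantHom_word349)
open Literature.MathematicalPhysics.QuantumFieldTheory.Balaban1983to89.B9Ineq385Kernel (hasKernelBound_rate_mono hasKernelBound_comp_decay)

/-! ## §1  The generic device: the four kernel members of the word `P = G′Q′*C⁻¹Q′G′` from (3.42) (both readings), (3.19), (3.48) -/

section Word

variable {g : B9.Geometry} [Fintype g.Site] {Rr : ℝ} {H : Prop}
variable {W : Type} [Fintype W] [DecidableEq W]

/-- **(3.49) FOR THE WORD `P = G′Q′*C⁻¹Q′G′`, GENERIC LETTERS, EXPLICIT CONSTANT** («For the operator P = I − R we obtain, using again Lemma 2.1, …»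
p. 399): the prefix `(X·G′)·Q′*·C⁻¹·Q′` is a block majorant ([4] (2.52)–(2.55), gen 11's `hasMajorantHom_word349`), and «majorant × kernel of the
right letter `G′·Y` ⇒ kernel» (`hasKernelBound_comp_decay`) keeps the printed factor `(L^{j′}η)^{−d}`; rates `ρ + (α+β)δ₀ ≦ ρ₁`, `ρ₁ + (2α+β)δ₀ ≦ δ`.
[cite: Balaban1985BackgroundPropagators, (3.49) p.399 + (3.25) p.394 + Thm 3.1 (3.42) p.397 + Thm 3.2 (3.48) p.398 + (3.19) p.393 + p.398 remark; Balaban1984PropagatorsII, (2.51)–(2.55) p.232 + Lemma 2.1 (2.60)–(2.61) p.234 + (2.64)–(2.66) p.234] -/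
theorem ineq349_kernel_word [DecidableEq g.Site] {KX KY : Type} (blk : W → g.Site) (d : ℕ) (δ₀ δ α β ρ ρ₁ Λ κQ BG B₁ : ℝ)
    (hκQ : 0 ≤ κQ) (hBG : 0 ≤ BG) (hB₁ : 0 ≤ B₁) (hΛ : 1 ≤ Λ) (hρ : 0 ≤ ρ) (hα : 0 ≤ α) (hβ : 0 ≤ β) (hδ₀ : 0 ≤ δ₀)
    (hr : ρ + (α + β) * δ₀ ≤ ρ₁) (hr₁ : ρ₁ + (2 * α + β) * δ₀ ≤ δ)
    -- the multiscale geometry 𝔅 and its axioms, [4] Lemma 2.1 at `β`, the p. 398 scale transfers at `α`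
    (hdnn : ∀ a a' : g.Site, 0 ≤ g.dist a a') (htri : Triangle254 (toB6 g Rr H)) (hrefl : ∀ y : g.Site, g.dist y y = 0)
    (hlen : ∀ y : g.Site, 0 < g.len y) (h261 : Ineq261 d (toB6 g Rr H) δ₀ β)
    (hT1 : ScaleTransfer g δ₀ α Λ (fun a => g.len a)) (hT2 : ScaleTransfer g δ₀ α Λ (fun a => g.len a ^ 2))
    (hT4 : ScaleTransfer g δ₀ α Λ (fun a => (g.len a ^ 4)⁻¹))
    -- THEOREM 3.1 for `G′`: (3.42)₁,₂ as block majorants for the left words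
    {Gp : Module.End ℝ (W → ℝ)} {X : KX → Module.End ℝ (W → ℝ)} {Y : KY → Module.End ℝ (W → ℝ)}
    (h342_1 : HasMajorant (g := toB6 g Rr H) blk Gp (fun a a' => BG * g.len a ^ 2 * Real.exp (-(δ * g.dist a a'))))
    (h342_2 : ∀ k : KX, HasMajorant (g := toB6 g Rr H) blk (X k * Gp) (fun a a' => BG * g.len a * Real.exp (-(δ * g.dist a a'))))
    -- THEOREM 3.1 for `G′`: (3.42)₁,₃ as kernel bounds for the right words (pairing `c`, block volume weight `v`)
    {v : g.Site → ℝ} (hv : ∀ y, 0 < v y) {c : ℝ} (hc : 0 < c)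
    (hGpk : HasKernelBound (g := toB6 g Rr H) blk v c Gp (fun a a' => BG * g.len a ^ 2 * Real.exp (-(δ * g.dist a a'))))
    (hGpYk : ∀ l : KY, HasKernelBound (g := toB6 g Rr H) blk v c (Gp * Y l) (fun a a' => BG * g.len a * Real.exp (-(δ * g.dist a a'))))
    -- the (3.19) letters `Q′`, `Q′*` between the sites and the coarse lattice 𝔅, block-local; THEOREM 3.2: `C⁻¹` with the (3.48) majorant on 𝔅
    {Qc : (W → ℝ) →ₗ[ℝ] (g.Site → ℝ)} {Qcs : (g.Site → ℝ) →ₗ[ℝ] (W → ℝ)} {Cinv : Module.End ℝ (g.Site → ℝ)}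
    (hQc : HasMajorantHom (g := toB6 g Rr H) blk (fun y : g.Site => y) Qc (fun a a' : g.Site => if a = a' then κQ else 0))
    (hQcs : HasMajorantHom (g := toB6 g Rr H) (fun y : g.Site => y) blk Qcs (fun a a' : g.Site => if a = a' then κQ else 0))
    (hCinv : HasMajorant (g := toB6 g Rr H) (fun y : g.Site => y) Cinv (fun a a' => B₁ * (g.len a ^ 4)⁻¹ * Real.exp (-(δ * g.dist a a')))) :
    HasKernelBound (g := toB6 g Rr H) blk v c (Gp ∘ₗ Qcs ∘ₗ Cinv ∘ₗ Qc ∘ₗ Gp)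
        (fun a a' => (κQ ^ 2 * BG * B₁ * 1 * Λ ^ 4 * B6.c1 d δ₀ β ^ 2 * BG * Λ * B6.c1 d δ₀ β) * Real.exp (-(ρ * g.dist a a'))) ∧
      (∀ k : KX, HasKernelBound (g := toB6 g Rr H) blk v c (X k * (Gp ∘ₗ Qcs ∘ₗ Cinv ∘ₗ Qc ∘ₗ Gp))
        (fun a a' => (κQ ^ 2 * BG * B₁ * 1 * Λ ^ 4 * B6.c1 d δ₀ β ^ 2 * BG * Λ * B6.c1 d δ₀ β) * (g.len a)⁻¹ * Real.exp (-(ρ * g.dist a a')))) ∧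
      (∀ l : KY, HasKernelBound (g := toB6 g Rr H) blk v c ((Gp ∘ₗ Qcs ∘ₗ Cinv ∘ₗ Qc ∘ₗ Gp) * Y l)
        (fun a a' => (κQ ^ 2 * BG * B₁ * 1 * Λ ^ 4 * B6.c1 d δ₀ β ^ 2 * BG * Λ * B6.c1 d δ₀ β) * (g.len a)⁻¹ * Real.exp (-(ρ * g.dist a a')))) ∧
      (∀ (k : KX) (l : KY), HasKernelBound (g := toB6 g Rr H) blk v c (X k * (Gp ∘ₗ Qcs ∘ₗ Cinv ∘ₗ Qc ∘ₗ Gp) * Y l)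
        (fun a a' => (κQ ^ 2 * BG * B₁ * 1 * Λ ^ 4 * B6.c1 d δ₀ β ^ 2 * BG * Λ * B6.c1 d δ₀ β) * (g.len a ^ 2)⁻¹ * Real.exp (-(ρ * g.dist a a')))) := by
  classical
  have hΛ0 : 0 ≤ Λ := zero_le_one.trans hΛ
  have hc1 : 0 ≤ B6.c1 d δ₀ β := B6RandomWalk.c1_nonneg d δ₀ β
  have hρ₁ : 0 ≤ ρ₁ := by nlinarith
  have hρδ : ρ ≤ δ := by nlinarith
  have hA₁ : 0 ≤ κQ ^ 2 * BG * B₁ * 1 * Λ ^ 4 * B6.c1 d δ₀ β ^ 2 :=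
    mul_nonneg (mul_nonneg (mul_nonneg (mul_nonneg (mul_nonneg (sq_nonneg _) hBG) hB₁) zero_le_one) (pow_nonneg hΛ0 4)) (sq_nonneg _)
  -- the identity letter `Y = 1` with the majorant `e^{−δd}` (`d(y,y) = 0`) and its trivial scale transfer
  have hY1 : HasMajorantHom (g := toB6 g Rr H) blk blk (LinearMap.id : (W → ℝ) →ₗ[ℝ] (W → ℝ))
      (fun a a' => (1 : ℝ) * (fun _ : g.Site => (1 : ℝ)) a * Real.exp (-(δ * g.dist a a'))) := by
    intro y' μ Bμ hμ x
    rw [LinearMap.id_apply]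
    dsimp only
    by_cases hx : blk x = y'
    · rw [hx, hrefl, mul_zero, neg_zero, Real.exp_zero]
      simpa using hμ.bound x hx
    · rw [hμ.off x hx, abs_zero]
      exact mul_nonneg (by positivity) hμ.nonneg
  have hSTone : ScaleTransfer g δ₀ α Λ (fun _ : g.Site => (1 : ℝ)) := fun y y' => by
    simp only [mul_one]
    have h0 : 0 ≤ α * δ₀ * g.dist y y' := mul_nonneg (mul_nonneg hα hδ₀) (hdnn y y')
    exact (Real.exp_le_one_iff.mpr (by linarith)).trans hΛ
  -- the left letters `X·G′`, `X ∈ {1, X_k}`, as two-space majorants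
  have hXE : HasMajorantHom (g := toB6 g Rr H) blk blk (Gp : (W → ℝ) →ₗ[ℝ] (W → ℝ))
      (fun a a' => BG * g.len a ^ 2 * Real.exp (-(δ * g.dist a a'))) := (hasMajorantHom_iff (g := toB6 g Rr H) _ _ _).mpr h342_1
  have hXDE : ∀ k : KX, HasMajorantHom (g := toB6 g Rr H) blk blk ((X k * Gp : Module.End ℝ (W → ℝ)) : (W → ℝ) →ₗ[ℝ] (W → ℝ))
      (fun a a' => BG * g.len a * Real.exp (-(δ * g.dist a a'))) := fun k => (hasMajorantHom_iff (g := toB6 g Rr H) _ _ _).mpr (h342_2 k)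
  -- the right words `G′·Y`, `Y ∈ {1, Y_l}`, in KERNEL form at the rate `ρ`
  have hKE' : HasKernelBound (g := toB6 g Rr H) blk v c Gp (fun a a' => BG * g.len a ^ 2 * Real.exp (-(ρ * g.dist a a'))) :=
    hasKernelBound_rate_mono (R := Rr) (H := H) _ hv c BG (fun a => g.len a ^ 2) hBG (fun a => sq_nonneg _) hρδ hdnn hGpk
  have hKED' : ∀ l : KY, HasKernelBound (g := toB6 g Rr H) blk v c (Gp * Y l) (fun a a' => BG * g.len a * Real.exp (-(ρ * g.dist a a'))) := fun l =>
    hasKernelBound_rate_mono (R := Rr) (H := H) _ hv c BG (fun a => g.len a) hBG (fun a => (hlen a).le) hρδ hdnn (hGpYk l)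
  -- the prefix words `(X·G′)·Q′*·C⁻¹·Q′` (gen 11's two-space word calculus, `Y = 1`), rate `ρ₁`
  have hW1 := hasMajorantHom_word349 (R := Rr) (H := H) blk blk blk (fun y : g.Site => y) d δ₀ δ α β ρ₁ Λ κQ BG B₁ 1
    (fun a => g.len a ^ 2) (fun _ => (1 : ℝ)) (fun a => sq_nonneg _) (fun _ => zero_le_one)
    hκQ hBG hB₁ zero_le_one hΛ hρ₁ hα hβ hδ₀ hr₁ hdnn htri h261 hSTone hT4 hXE hY1 hQc hQcs hCinv
  have hW2 := fun k : KX => hasMajorantHom_word349 (R := Rr) (H := H) blk blk blk (fun y : g.Site => y) d δ₀ δ α β ρ₁ Λ κQ BG B₁ 1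
    (fun a => g.len a) (fun _ => (1 : ℝ)) (fun a => (hlen a).le) (fun _ => zero_le_one)
    hκQ hBG hB₁ zero_le_one hΛ hρ₁ hα hβ hδ₀ hr₁ hdnn htri h261 hSTone hT4 (hXDE k) hY1 hQc hQcs hCinv
  -- weight bookkeeping
  have i11 : ∀ a : g.Site, g.len a ^ 2 * ((g.len a ^ 4)⁻¹ * 1) * g.len a ^ 2 = 1 := fun a => by
    have hℓ : g.len a ≠ 0 := (hlen a).ne'
    field_simp
  have i21 : ∀ a : g.Site, g.len a * ((g.len a ^ 4)⁻¹ * 1) * g.len a ^ 2 = (g.len a)⁻¹ := fun a => by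
    have hℓ : g.len a ≠ 0 := (hlen a).ne'
    field_simp
  have i12 : ∀ a : g.Site, g.len a ^ 2 * ((g.len a ^ 4)⁻¹ * 1) * g.len a = (g.len a)⁻¹ := fun a => by
    have hℓ : g.len a ≠ 0 := (hlen a).ne'
    field_simp
  have i22 : ∀ a : g.Site, g.len a * ((g.len a ^ 4)⁻¹ * 1) * g.len a = (g.len a ^ 2)⁻¹ := fun a => by
    have hℓ : g.len a ≠ 0 := (hlen a).ne'
    field_simp
  have hw₁ : ∀ a : g.Site, 0 ≤ g.len a ^ 2 * ((g.len a ^ 4)⁻¹ * 1) := fun a => by positivity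
  have hw₁' : ∀ a : g.Site, 0 ≤ g.len a * ((g.len a ^ 4)⁻¹ * 1) := fun a =>
    mul_nonneg (hlen a).le (mul_nonneg (inv_nonneg.mpr (by positivity)) zero_le_one)
  refine ⟨?_, fun k => ?_, fun l => ?_, fun k l => ?_⟩
  · -- (3.49)₁: `P = (G′Q′*C⁻¹Q′) · G′`
    have hcmp := hasKernelBound_comp_decay (R := Rr) (H := H) blk d δ₀ α β ρ ρ₁ Λ (κQ ^ 2 * BG * B₁ * 1 * Λ ^ 4 * B6.c1 d δ₀ β ^ 2) BG
      (fun a => g.len a ^ 2 * ((g.len a ^ 4)⁻¹ * 1)) (fun a => g.len a ^ 2) hw₁ (fun a => sq_nonneg _) hΛ0 hA₁ hBG hρ hr hdnn htri hT2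
      h261 hv hc ((hasMajorantHom_iff (g := toB6 g Rr H) _ _ _).mp hW1) hKE'
    have hop : (Gp ∘ₗ Qcs ∘ₗ Cinv ∘ₗ Qc ∘ₗ Gp) = ((Gp : (W → ℝ) →ₗ[ℝ] (W → ℝ)) ∘ₗ Qcs ∘ₗ Cinv ∘ₗ Qc ∘ₗ LinearMap.id) * Gp :=
      LinearMap.ext fun F => by simp only [Module.End.mul_apply, LinearMap.comp_apply, LinearMap.id_apply]
    rw [hop]
    refine hasKernelBound_mono (g := toB6 g Rr H) _ hv hcmp fun a a' => le_of_eq ?_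
    rw [i11 a]
    ring
  · -- (3.49)₂: `X_k·P`
    have hcmp := hasKernelBound_comp_decay (R := Rr) (H := H) blk d δ₀ α β ρ ρ₁ Λ (κQ ^ 2 * BG * B₁ * 1 * Λ ^ 4 * B6.c1 d δ₀ β ^ 2) BG
      (fun a => g.len a * ((g.len a ^ 4)⁻¹ * 1)) (fun a => g.len a ^ 2) hw₁' (fun a => sq_nonneg _) hΛ0 hA₁ hBG hρ hr hdnn htri hT2
      h261 hv hc ((hasMajorantHom_iff (g := toB6 g Rr H) _ _ _).mp (hW2 k)) hKE'
    have hop : X k * (Gp ∘ₗ Qcs ∘ₗ Cinv ∘ₗ Qc ∘ₗ Gp) = (((X k * Gp : Module.End ℝ (W → ℝ)) : (W → ℝ) →ₗ[ℝ] (W → ℝ)) ∘ₗ Qcs ∘ₗ Cinv ∘ₗ Qc ∘ₗ LinearMap.id) * Gp :=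
      LinearMap.ext fun F => by simp only [Module.End.mul_apply, LinearMap.comp_apply, LinearMap.id_apply]
    rw [hop]
    refine hasKernelBound_mono (g := toB6 g Rr H) _ hv hcmp fun a a' => le_of_eq ?_
    rw [i21 a]
  · -- (3.49)₃: `P·Y_l`
    have hcmp := hasKernelBound_comp_decay (R := Rr) (H := H) blk d δ₀ α β ρ ρ₁ Λ (κQ ^ 2 * BG * B₁ * 1 * Λ ^ 4 * B6.c1 d δ₀ β ^ 2) BG
      (fun a => g.len a ^ 2 * ((g.len a ^ 4)⁻¹ * 1)) (fun a => g.len a) hw₁ (fun a => (hlen a).le) hΛ0 hA₁ hBG hρ hr hdnn htri hT1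
      h261 hv hc ((hasMajorantHom_iff (g := toB6 g Rr H) _ _ _).mp hW1) (hKED' l)
    have hop : (Gp ∘ₗ Qcs ∘ₗ Cinv ∘ₗ Qc ∘ₗ Gp) * Y l = ((Gp : (W → ℝ) →ₗ[ℝ] (W → ℝ)) ∘ₗ Qcs ∘ₗ Cinv ∘ₗ Qc ∘ₗ LinearMap.id) * (Gp * Y l) :=
      LinearMap.ext fun F => by simp only [Module.End.mul_apply, LinearMap.comp_apply, LinearMap.id_apply]
    rw [hop]
    refine hasKernelBound_mono (g := toB6 g Rr H) _ hv hcmp fun a a' => le_of_eq ?_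
    rw [i12 a]
  · -- (3.49)₄: `X_k·P·Y_l`
    have hcmp := hasKernelBound_comp_decay (R := Rr) (H := H) blk d δ₀ α β ρ ρ₁ Λ (κQ ^ 2 * BG * B₁ * 1 * Λ ^ 4 * B6.c1 d δ₀ β ^ 2) BG
      (fun a => g.len a * ((g.len a ^ 4)⁻¹ * 1)) (fun a => g.len a) hw₁' (fun a => (hlen a).le) hΛ0 hA₁ hBG hρ hr hdnn htri hT1
      h261 hv hc ((hasMajorantHom_iff (g := toB6 g Rr H) _ _ _).mp (hW2 k)) (hKED' l)
    have hop : X k * (Gp ∘ₗ Qcs ∘ₗ Cinv ∘ₗ Qc ∘ₗ Gp) * Y l =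
        (((X k * Gp : Module.End ℝ (W → ℝ)) : (W → ℝ) →ₗ[ℝ] (W → ℝ)) ∘ₗ Qcs ∘ₗ Cinv ∘ₗ Qc ∘ₗ LinearMap.id) * (Gp * Y l) :=
      LinearMap.ext fun F => by simp only [Module.End.mul_apply, LinearMap.comp_apply, LinearMap.id_apply]
    rw [hop]
    refine hasKernelBound_mono (g := toB6 g Rr H) _ hv hcmp fun a a' => le_of_eq ?_
    rw [i22 a]

end Word

/-! ## §2  The printed instance: `P(U)` on the sites `S × ι`, the letters `∇_k = conj b (diffLetter T U η⁻¹ k)`, Theorem 3.2 in its own typing, rate `δ₀/2` -/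

section Printed

variable {𝔸 : Type*} [NormedRing 𝔸] [NormedAlgebra ℂ 𝔸] {ι : Type} [Fintype ι]
variable (b : Module.Basis ι ℝ 𝔸) {S : Type} {κ : Type}
variable (T : κ → Equiv.Perm S) (U : κ → S → 𝔸ˣ)
variable {g : B9.Geometry} [Fintype g.Site] {Rr : ℝ} {H : Prop}

/-- **(3.49) FOR PRINT'S OWN `P(U) = G′(U)Q′*(U)(Q′G′²Q′*)⁻¹(U)Q′(U)G′(U)` IN THE PRINTED KERNEL FORM AT THE PRINTED RATE `(1/2)δ₀`** — p. 399 «For the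
operator P = I − R we obtain, using again Lemma 2.1, [|P(x,x′)|, |(DP)_μ(x,x′)|, |(PD*)_ν(x,x′)|, |(DPD*)_{μν}(x,x′)|] ≦ O(1)[1, (Lʲη)⁻¹, (Lʲη)⁻¹,
(Lʲη)⁻²](L^{j′}η)^{−d}e^{−(1/2)δ₀d(y,y′)} for x ∈ Δ(y), y ∈ Λ_j, x′ ∈ Δ(y′), y′ ∈ Λ_{j′}»: given Theorem 3.1 for `G′(U)` ((3.42)₁,₂ as block majorants,
(3.42)₁,₃ as kernel bounds, rate `δ₀`), Theorem 3.2 for `U` (the (3.48) kernel bound `B₁`, rate `δ₀`), the (3.19) letters `Q′(U)`, `Q′*(U)` (block-local,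
size `κ_Q`), [4] Lemma 2.1 «for every 0 < α < 1» and the p. 398 scale transfer for every exponent: `∃ K ≧ 0` such that for `P(U) = G′ ∘ Q′* ∘ C⁻¹ ∘
Q′ ∘ G′`: `|P(U)(x,x′)| ≦ Ke^{−(δ₀/2)d}v(y′)⁻¹`, `|(∇_kP(U))(x,x′)|, |(P(U)∇*_l)(x,x′)| ≦ K(Lʲη)⁻¹e^{−(δ₀/2)d}v⁻¹`, `|(∇_kP(U)∇*_l)(x,x′)| ≦
K(Lʲη)⁻²e^{−(δ₀/2)d}v⁻¹`, all `k, l : κ ⊕ κ`.  Exponents `α = β = 1/10`: `δ₀ − 3δ₀/10 − 2δ₀/10 = δ₀/2`.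
[cite: Balaban1985BackgroundPropagators, (3.49) p.399 + (3.25) p.394 + Thm 3.1 (3.42) p.397 + Thm 3.2 (3.48) p.398 + (3.19) p.393 + p.398 remark; Balaban1984PropagatorsII, (2.51)–(2.55) p.232 + Lemma 2.1 (2.60)–(2.61) p.234 + (2.64)–(2.66) p.234] -/
theorem ineq349_kernel_printed [Fintype S] [DecidableEq S] [DecidableEq ι] [DecidableEq g.Site] (blk : S → g.Site) (d : ℕ)
    (δ₀ κQ BG B₁ : ℝ) (hκQ : 0 < κQ) (hBG : 0 < BG) (hB₁ : 0 < B₁) (hδ₀ : 0 < δ₀)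
    -- the multiscale geometry 𝔅 and its axioms
    (hdnn : ∀ a a' : g.Site, 0 ≤ g.dist a a') (htri : Triangle254 (toB6 g Rr H)) (hrefl : ∀ y : g.Site, g.dist y y = 0)
    (hlen : ∀ y : g.Site, 0 < g.len y)
    -- [4] Lemma 2.1 (2.61) at the rate `δ₀`, «for every 0 < α < 1», and the p. 398 scale transfer for every exponent (FILE 30's shapes)
    (h261 : ∀ α : ℝ, 0 < α → α < 1 → Ineq261 d (toB6 g Rr H) δ₀ α)
    (hST : ∀ α : ℝ, 0 < α → ∃ Λ : ℝ, 1 ≤ Λ ∧ ScaleTransfer g δ₀ α Λ (fun a => g.len a) ∧ ScaleTransfer g δ₀ α Λ (fun a => g.len a ^ 2) ∧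
      ScaleTransfer g δ₀ α Λ (fun a => (g.len a)⁻¹) ∧ ScaleTransfer g δ₀ α Λ (fun a => (g.len a ^ 2)⁻¹) ∧
      ScaleTransfer g δ₀ α Λ (fun a => (g.len a ^ 4)⁻¹) ∧ ScaleTransfer g δ₀ α Λ (fun y => g.len y ^ (-(4 : ℝ))))
    -- THEOREM 3.1 for `G′(U)`: (3.42)₁,₂ as block majorants at the rate `δ₀`
    {Gp : Module.End ℝ (S × ι → ℝ)}
    (h342_1 : HasMajorant (g := toB6 g Rr H) (fun p : S × ι => blk p.1) Gp
      (fun a a' => BG * g.len a ^ 2 * Real.exp (-(δ₀ * g.dist a a'))))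
    (h342_2 : ∀ k : κ ⊕ κ, HasMajorant (g := toB6 g Rr H) (fun p : S × ι => blk p.1)
      (conj b (diffLetter T U ((g.eta : ℂ)⁻¹) k) * Gp) (fun a a' => BG * g.len a * Real.exp (-(δ₀ * g.dist a a'))))
    -- THEOREM 3.1 for `G′(U)`: (3.42)₁,₃ as PRINTED KERNEL BOUNDS (pairing `cK = η^d`, block volume weight `v(y′) = (L^{j′}η)^d`), rate `δ₀`
    {v : g.Site → ℝ} (hv : ∀ y, 0 < v y) {cK : ℝ} (hcK : 0 < cK)
    (hGpk : HasKernelBound (g := toB6 g Rr H) (fun p : S × ι => blk p.1) v cK Gp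
      (fun a a' => BG * g.len a ^ 2 * Real.exp (-(δ₀ * g.dist a a'))))
    (hGpDk : ∀ l : κ ⊕ κ, HasKernelBound (g := toB6 g Rr H) (fun p : S × ι => blk p.1) v cK
      (Gp * conj b (diffLetter T U ((g.eta : ℂ)⁻¹) l)) (fun a a' => BG * g.len a * Real.exp (-(δ₀ * g.dist a a'))))
    -- the (3.19) letters `Q′(U)`, `Q′*(U)` in their own typing with block-local two-space majorants
    {Qc : (S × ι → ℝ) →ₗ[ℝ] (g.Site → ℝ)} {Qcs : (g.Site → ℝ) →ₗ[ℝ] (S × ι → ℝ)} {Linv : Module.End ℝ (g.Site → ℝ)}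
    (hQc : HasMajorantHom (g := toB6 g Rr H) (fun p : S × ι => blk p.1) (fun y : g.Site => y) Qc
      (fun a a' : g.Site => κQ * (if a = a' then (1 : ℝ) else 0)))
    (hQcs : HasMajorantHom (g := toB6 g Rr H) (fun y : g.Site => y) (fun p : S × ι => blk p.1) Qcs
      (fun a a' : g.Site => κQ * (if a = a' then (1 : ℝ) else 0)))
    -- THEOREM 3.2 for `U`: `C⁻¹(U) = (Q′G′²Q′*)⁻¹` has the KERNEL bound (3.48) at the rate `δ₀`
    (h348 : ∀ y y' : g.Site, |B9Thm34Inv.ker (B9Thm34Inv.vol g d) Linv y y'| ≤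
      B₁ * g.len y ^ (-(4 : ℝ)) * g.len y' ^ (-(d : ℝ)) * Real.exp (-(δ₀ * g.dist y y'))) :
    ∃ K : ℝ, 0 ≤ K ∧
      HasKernelBound (g := toB6 g Rr H) (fun p : S × ι => blk p.1) v cK (Gp ∘ₗ Qcs ∘ₗ Linv ∘ₗ Qc ∘ₗ Gp)
        (fun a a' => K * Real.exp (-(1 / 2 * δ₀ * g.dist a a'))) ∧
      (∀ k : κ ⊕ κ, HasKernelBound (g := toB6 g Rr H) (fun p : S × ι => blk p.1) v cK
        (conj b (diffLetter T U ((g.eta : ℂ)⁻¹) k) * (Gp ∘ₗ Qcs ∘ₗ Linv ∘ₗ Qc ∘ₗ Gp))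
        (fun a a' => K * (g.len a)⁻¹ * Real.exp (-(1 / 2 * δ₀ * g.dist a a')))) ∧
      (∀ l : κ ⊕ κ, HasKernelBound (g := toB6 g Rr H) (fun p : S × ι => blk p.1) v cK
        ((Gp ∘ₗ Qcs ∘ₗ Linv ∘ₗ Qc ∘ₗ Gp) * conj b (diffLetter T U ((g.eta : ℂ)⁻¹) l))
        (fun a a' => K * (g.len a)⁻¹ * Real.exp (-(1 / 2 * δ₀ * g.dist a a')))) ∧
      (∀ k l : κ ⊕ κ, HasKernelBound (g := toB6 g Rr H) (fun p : S × ι => blk p.1) v cK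
        (conj b (diffLetter T U ((g.eta : ℂ)⁻¹) k) * (Gp ∘ₗ Qcs ∘ₗ Linv ∘ₗ Qc ∘ₗ Gp) * conj b (diffLetter T U ((g.eta : ℂ)⁻¹) l))
        (fun a a' => K * (g.len a ^ 2)⁻¹ * Real.exp (-(1 / 2 * δ₀ * g.dist a a')))) := by
  classical
  -- the p. 398 scale transfers and [4] Lemma 2.1 at exponent `1/10`
  obtain ⟨Λ, hΛ1, hT1, hT2, -, -, hT4, -⟩ := hST (1 / 10) (by norm_num)
  have hΛ0 : 0 ≤ Λ := zero_le_one.trans hΛ1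
  have h261β : Ineq261 d (toB6 g Rr H) δ₀ (1 / 10) := h261 _ (by norm_num) (by norm_num)
  have hc1 : 0 ≤ B6.c1 d δ₀ (1 / 10) := B6RandomWalk.c1_nonneg d δ₀ (1 / 10)
  -- `C⁻¹(U)`: the (3.48) kernel bound read as a block majorant on 𝔅 (identity block map)
  have hr4 : ∀ a : g.Site, g.len a ^ (-(4 : ℝ)) = (g.len a ^ 4)⁻¹ := fun a => by
    rw [Real.rpow_neg (hlen a).le, show (4 : ℝ) = ((4 : ℕ) : ℝ) by norm_num, Real.rpow_natCast]
  have hCinvM : HasMajorant (g := toB6 g Rr H) (fun y : g.Site => y) Linv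
      (fun a a' => B₁ * (g.len a ^ 4)⁻¹ * Real.exp (-(δ₀ * g.dist a a'))) :=
    hasMajorant_mono (g := toB6 g Rr H) _
      (hasMajorant_id_of_ker (R := Rr) (H := H) d hlen B₁ (fun y => g.len y ^ (-(4 : ℝ))) (fun y y' => Real.exp (-(δ₀ * g.dist y y'))) h348)
      fun a a' => le_of_eq (by simp only [hr4])
  -- the (3.19) letters with the plain block-local majorant `κ_Q·𝟙[y = y′]`
  have hQc1 : HasMajorantHom (g := toB6 g Rr H) (fun p : S × ι => blk p.1) (fun y : g.Site => y) Qc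
      (fun a a' : g.Site => if a = a' then κQ else 0) :=
    hasMajorantHom_mono (g := toB6 g Rr H) _ _ hQc fun a a' => le_of_eq (by split_ifs <;> simp)
  have hQcs1 : HasMajorantHom (g := toB6 g Rr H) (fun y : g.Site => y) (fun p : S × ι => blk p.1) Qcs
      (fun a a' : g.Site => if a = a' then κQ else 0) :=
    hasMajorantHom_mono (g := toB6 g Rr H) _ _ hQcs fun a a' => le_of_eq (by split_ifs <;> simp)
  -- rates: `δ₀/2 + (1/10 + 1/10)δ₀ = 7δ₀/10`, `7δ₀/10 + (2/10 + 1/10)δ₀ = δ₀`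
  have hρ0 : (0 : ℝ) ≤ 1 / 2 * δ₀ := by linarith
  have hr : 1 / 2 * δ₀ + (1 / 10 + 1 / 10) * δ₀ ≤ 7 / 10 * δ₀ := by linarith
  have hr₁ : 7 / 10 * δ₀ + (2 * (1 / 10) + 1 / 10) * δ₀ ≤ δ₀ := by linarith
  have hK : 0 ≤ κQ ^ 2 * BG * B₁ * 1 * Λ ^ 4 * B6.c1 d δ₀ (1 / 10) ^ 2 * BG * Λ * B6.c1 d δ₀ (1 / 10) := by positivity
  obtain ⟨h1, h2, h3, h4⟩ := ineq349_kernel_word (Rr := Rr) (H := H) (fun p : S × ι => blk p.1) d δ₀ δ₀ (1 / 10) (1 / 10) (1 / 2 * δ₀)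
    (7 / 10 * δ₀) Λ κQ BG B₁ hκQ.le hBG.le hB₁.le hΛ1 hρ0 (by norm_num) (by norm_num) hδ₀.le hr hr₁ hdnn htri hrefl hlen h261β hT1 hT2 hT4
    (X := fun k : κ ⊕ κ => conj b (diffLetter T U ((g.eta : ℂ)⁻¹) k)) (Y := fun l : κ ⊕ κ => conj b (diffLetter T U ((g.eta : ℂ)⁻¹) l))
    h342_1 h342_2 hv hcK hGpk hGpDk hQc1 hQcs1 hCinvM
  exact ⟨_, hK, h1, h2, h3, h4⟩

end Printed

end Literature.MathematicalPhysics.QuantumFieldTheory.Balaban1983to89.B9Ineq349KernelU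

end
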